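import Summits.QuantumFields.BalabanUV.Beta.FP.TransportInfinityM
import Summits.QuantumFields.BalabanUV.Beta.FP.KSlotHolds
import Summits.QuantumFields.BalabanUV.Beta.GAN24.KSlotJMHolds
import Summits.QuantumFields.BalabanUV.Beta.GAN24.RespStepDecay
import Summits.QuantumFields.BalabanUV.Beta.GAN24.WoodburyFibreZeroModeMinimiserLeg

/-!
# `BalabanUV.Beta.FP.PerfectColumnSharp` — road «FP» for binder row D1, rows N7∕IPROF-UNIF (its LOCATED residual) and N7∕MS-2 (order 1):
# THE PERFECT MINIMISER COLUMN IS `O((Lc^m)⁻⁵)` POINTWISE AND ITS UNIT DIFFERENCES ARE `O((Lc^m)⁻⁶)`, WITH EXPONENTIAL DECAY ON THE BLOCK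
# SCALE, `m`-UNIFORMLY — `|colOf (KPerf Lc (sfStep Lc) (smStep 3 Lc) m) κ l p| ≤ C·((Lc:ℝ)^m)⁻⁵·e^{−(κ₀∕(4·Lc^m))·|p|₁}` and
# `|colOf (…) κ l (p + e_ν) − colOf (…) κ l p| ≤ C′·((Lc:ℝ)^m)⁻⁶·e^{−(κ₀∕(4·Lc^m))·|p|₁}` for every `m ≥ 1`, ONE `κ₀`, `C`, `C′`

NOT IN PRINT; OUR BOOKKEEPING ([folklore] triangle inequality over the `M⁵` indices of a block contour + floor arithmetic of block labels + a
dominated limit) over leaf-16's (N1) `FineReadoutDecay.exists_wH_decay` and leaf-19's (N1′) `FineReadoutGradientDecay.exists_wH_grad_decay`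
(joint form `exists_wH_decay_and_grad`) and this lineage's X1m-K limit (`TransportInfinityM.tendsto_wStepM_of_decays` on
`KSlotJMHolds.kSlotJM_holds`), all BY NAME.  HONEST FRAMING (cell contract, verbatim): «discharging `BetaPertH` makes Bałaban's UV stability
UNCONDITIONAL — a real constructive-QFT result; it is NOT the continuum limit and NOT the Clay problem.»  HONEST DEPENDENCY (verbatim): «continuum
YM on T⁴ ⇐ BetaPertH ∧ nine spine estimates (0/9 proved); BetaPertH ⇐ (D1) ∧ (D4) ∧ CAP+tail; G-an2-4 gates asym, D1 and NE2/3/4.»  THIS MODULE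
DISCHARGES NOTHING of N7 ∕ `hasym` ∕ H4-ASM ∕ row D1: it sharpens the power of row IPROF-UNIF's DISPLAYED shape from `p = 1`
(`FP/PerfectColumnUniform`, whose header locates «the power the consumer needs, `p = 5`, is NOT reached»; route (γ) `FP/PerfectColumnMass` met the
consumer in `ℓ¹`-mean instead — it STANDS, nothing is re-opened) to `p = 5` IN SUP, and adds the first-difference gain `p = 6` (row N7∕MS-2 at order 1;
orders 2–3 would need second∕third-difference analogues of (N1′), not in the tree — NOT claimed).  No `def`, no `def … : Prop`, nothing cited, 0 sorry;
NEVER «G-an2-4 closed», NOT (CONV-C) for G_k∕H_k, NOT D1, NOT BetaPertH, NOT continuum, NOT Clay.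

ABSOLUTE RULE (cell charter, verbatim): «No internally-minted statement may enter as a cited fact. Every hypothesis is either kernel-proved in this
package or a verbatim quotation of a PUBLISHED theorem with page reference. The manuscript(s) under audit are NOT citable for their own disputed steps
— they are the thing under adjudication; programme-internal (2001/route/tribunal) claims are never citable.»

WHY IT CLOSES.  `TransportInfinityM.stepColM_eq`: the `(j, m)` transport weight is a PLAIN CONTOUR SUM of the level-`N` fine minimiser column,
`wStepM Lc m j κ l p = Lc^{5j}·Σ_{i ∈ LegIdx 3 M} M⁻⁵·wH (N := Lc^(j+m)) κ l (legOff κ i − M•p)`, `M = Lc^j`, `N = Lc^(j+m) = M·Lc^m`, `M⁵` indices of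
weight `M⁻⁵` (`OneStepKernelFamily.sum_legW`).  (N1) `|wH_N| ≤ C·N⁻⁵·e^{−κ₀‖quo_N ·‖∞}` gives `|wStepM| ≤ Lc^{5j}·C·N⁻⁵ = C·(Lc^m)⁻⁵` (times the
block-label wobble `e^{2κ₀}`: `RespStepDecay.supNorm_quo_sub_le_add` — the contour offsets are `< 2M` — and `WoodburyFibreZeroModeMinimiserLeg.exp_supNorm_quo_le`);
(N1′) `|Δ_ν wH_N| ≤ C′·N⁻⁶·e^{−κ₀‖quo_N ·‖∞}` and the telescoping of the shift `M•e_ν` into `M` unit steps (`RespStepDecay.sub_eq_sum_range_step`) give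
`|Δ_ν wStepM| ≤ Lc^{5j}·M·C′·N⁻⁶ = C′·(Lc^m)⁻⁶` (wobble `e^{4κ₀}`), BOTH UNIFORMLY IN `j`; NO rebase (it would let the constant depend on `m`).  The limit
`j → ∞` is entrywise (`tendsto_wStepM_of_decays` + `le_of_tendsto'`).

CONTENT (`d = 3`; §1 every `Lc ≥ 1`, §2 `2 ≤ Lc`):
* §0 [folklore] helpers: `legOff_bounds` (`0 ≤ (legOff κ i)_q < 2M` on `LegIdx 3 M`), `legOff_step_bounds` (`< 3M` after `t < M` unit steps), `l1_single`,
  `l1_le_l1_add_single_add_one`, `sum_inv_pow_LegIdx` (`Σ_{LegIdx 3 M} M⁻⁵ = 1`), `pow_ratio_five`∕`pow_ratio_six` (`Lc^{5j}·(Lc^(j+m))⁻⁵ = (Lc^m)⁻⁵`, …),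
  `exp_block_to_l1` (`e^{−κ₀‖quo_N (r − M•p)‖∞} ≤ e^{(n+2)κ₀}·e^{−(κ₀∕(4·Lc^m))·|p|₁}` for offsets `0 ≤ r < (n+1)M`).
* §1 **`abs_wStepM_le_sharp`**, **`abs_wStepM_sub_le_sharp`** and the joint **`wStepM_sharp`** (one `κ₀`): the finite-`j` bounds, uniform in `j` and `m ≥ 1`.
* §2 **`abs_colOf_KPerf_le_sharp`**, **`abs_colOf_KPerf_sub_le_sharp`**, joint **`colOf_KPerf_sharp`** (`2 ≤ Lc`): the perfect column, every `m ≥ 1`.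
Unit `b2b-balaban-gan24-p3` (gen 19; binder row G-an2-4 part P3 lineage = road-FP K-side supplier), 2026-08-20.
-/

noncomputable section

open Finset Filter Topology
open scoped BigOperators
open Literature.MathematicalPhysics.QuantumFieldTheory.LatticeForm (quo)
open Literature.MathematicalPhysics.QuantumFieldTheory.Balaban1983to89
open Literature.MathematicalPhysics.QuantumFieldTheory.Balaban1983to89.Beta
open B12Sec2to5 (l1 l1_nonneg)
open B4ContourShift (supNorm abs_le_supNorm supNorm_nonneg)
open KernelSpecInstance (wH)
open AffineAveraging (unitVec)
open OneStepKernelFamily (LegIdx legSet legW sum_legW l1_neg_eq)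
open HessianTelescopingKKT (legOff)
open ExpKernelCalculus (Decays l1_sub_triangle)
open Summit.QuantumFields.BalabanUV.Beta.HessKerDressedUnits (unitK)
open Summit.QuantumFields.BalabanUV.Beta.GAN24.CombesThomas (sfStep smStep)
open Summit.QuantumFields.BalabanUV.Beta.GAN24.KSlotJMHolds (kSlotJM_holds)
open Summit.QuantumFields.BalabanUV.Beta.GAN24.RespStepDecay (supNorm_quo_sub_le_add exp_wobble sub_eq_sum_range_step)
open Summit.QuantumFields.BalabanUV.Beta.GAN24.FineReadoutGradientDecay (exists_wH_decay_and_grad)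
open Summit.QuantumFields.BalabanUV.Beta.GAN24.WoodburyFibreZeroModeMinimiserLeg (exp_supNorm_quo_le)
open Summit.QuantumFields.BalabanUV.Beta.FP.KSlotHolds (sfStep_mul_smStep_three)
open Summit.QuantumFields.BalabanUV.Beta.FP.PerfectObjects (KTot)
open Summit.QuantumFields.BalabanUV.Beta.FP.PerfectObjectsT (KPerf)
open Summit.QuantumFields.BalabanUV.Beta.FP.TransportInfinityM (stepColM stepColM_eq wStepM colOf tendsto_wStepM_of_decays)

namespace Summit.QuantumFields.BalabanUV.Beta.FP.PerfectColumnSharp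

/-! ## §0 Helpers: contour offsets, `ℓ¹` of a unit step, the weight sum, the power counts, block label ↦ `ℓ¹` decay -/

section Helpers

/-- [folklore] The offsets of the decimation contour: `0 ≤ (legOff κ i)_q < 2M` for `i ∈ LegIdx 3 M`. -/
theorem legOff_bounds {M : ℕ} {i : (Fin (3 + 1) → ℕ) × ℕ} (hi : i ∈ LegIdx 3 M) (κ q : Fin (3 + 1)) :
    0 ≤ legOff κ i q ∧ legOff κ i q < ((1 + 1 : ℕ) : ℤ) * (M : ℤ) := by
  rw [LegIdx, Finset.mem_product, Fintype.mem_piFinset] at hi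
  have h1 : i.1 q < M := Finset.mem_range.1 (hi.1 q)
  have h2 : i.2 < M := Finset.mem_range.1 hi.2
  unfold legOff
  constructor
  · split_ifs <;> positivity
  · split_ifs <;> push_cast <;> omega

/-- [folklore] After `t < M` unit steps in direction `ν` the offsets stay in `[0, 3M)`. -/
theorem legOff_step_bounds {M : ℕ} {i : (Fin (3 + 1) → ℕ) × ℕ} (hi : i ∈ LegIdx 3 M) (κ ν : Fin (3 + 1)) {t : ℕ} (ht : t < M)
    (q : Fin (3 + 1)) :
    0 ≤ (legOff κ i + (t : ℤ) • unitVec ν) q ∧ (legOff κ i + (t : ℤ) • unitVec ν) q < ((2 + 1 : ℕ) : ℤ) * (M : ℤ) := by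
  obtain ⟨h0, h1⟩ := legOff_bounds hi κ q
  simp only [Pi.add_apply, Pi.smul_apply, AffineAveraging.unitVec_apply, smul_eq_mul]
  constructor
  · split_ifs <;> push_cast at h1 ⊢ <;> nlinarith
  · split_ifs <;> push_cast at h1 ⊢ <;> omega

/-- [folklore] `|e_ν|₁ = 1`. -/
theorem l1_single (ν : Fin (3 + 1)) : l1 (Pi.single ν (1 : ℤ) : Fin (3 + 1) → ℤ) = 1 := by
  unfold l1
  rw [Finset.sum_eq_single ν]
  · simp
  · intro μ _ hμ; simp [hμ]
  · intro h; exact absurd (Finset.mem_univ ν) h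

/-- [folklore] `|p|₁ ≤ |p + e_ν|₁ + 1`. -/
theorem l1_le_l1_add_single_add_one (p : Fin (3 + 1) → ℤ) (ν : Fin (3 + 1)) :
    l1 p ≤ l1 (p + Pi.single ν 1) + 1 := by
  have h := l1_sub_triangle p (p + Pi.single ν 1) 0
  rw [sub_zero, sub_zero, show p - (p + Pi.single ν 1) = -(Pi.single ν 1 : Fin (3 + 1) → ℤ) by abel, l1_neg_eq, l1_single] at h
  linarith

/-- [folklore] The decimation weights sum to one: `Σ_{i ∈ LegIdx 3 M} M⁻⁵ = 1` (`OneStepKernelFamily.sum_legW` at a field leg). -/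
theorem sum_inv_pow_LegIdx {M : ℕ} (hM : M ≠ 0) :
    ∑ _i ∈ LegIdx 3 M, (((M : ℝ)) ^ (3 + 2))⁻¹ = 1 := by
  have h := sum_legW (d := 3) hM (Sum.inl (0 : Fin (3 + 1)))
  simpa only [legSet, legW] using h

variable {Lc : ℕ} [NeZero Lc]

/-- [folklore] The power count of the sup bound: `Lc^{5j}·((Lc^(j+m))⁵)⁻¹ = ((Lc^m)⁵)⁻¹`. -/
theorem pow_ratio_five (j m : ℕ) :
    (Lc : ℝ) ^ (5 * j) * ((((Lc ^ (j + m) : ℕ) : ℝ)) ^ (3 + 2))⁻¹ = (((Lc : ℝ) ^ m) ^ 5)⁻¹ := by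
  have hL : (Lc : ℝ) ≠ 0 := by exact_mod_cast NeZero.ne Lc
  push_cast
  rw [show ((Lc : ℝ) ^ (j + m)) ^ (3 + 2) = (Lc : ℝ) ^ (5 * j) * ((Lc : ℝ) ^ m) ^ 5 by rw [pow_add]; ring]
  rw [mul_inv, ← mul_assoc, mul_inv_cancel₀ (pow_ne_zero _ hL), one_mul]

/-- [folklore] The power count of the difference bound: `Lc^{5j}·Lc^j·((Lc^(j+m))⁶)⁻¹ = ((Lc^m)⁶)⁻¹`. -/
theorem pow_ratio_six (j m : ℕ) :
    (Lc : ℝ) ^ (5 * j) * (((Lc ^ j : ℕ) : ℝ) * ((((Lc ^ (j + m) : ℕ) : ℝ)) ^ (3 + 3))⁻¹) = (((Lc : ℝ) ^ m) ^ 6)⁻¹ := by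
  have hL : (Lc : ℝ) ≠ 0 := by exact_mod_cast NeZero.ne Lc
  push_cast
  rw [show ((Lc : ℝ) ^ (j + m)) ^ (3 + 3) = ((Lc : ℝ) ^ (5 * j) * (Lc : ℝ) ^ j) * ((Lc : ℝ) ^ m) ^ 6 by rw [pow_add]; ring]
  rw [mul_inv, ← mul_assoc, ← mul_assoc, mul_inv_cancel₀ (mul_ne_zero (pow_ne_zero _ hL) (pow_ne_zero _ hL)), one_mul]

/-- [folklore] **BLOCK LABEL OF A CONTOUR POINT ↦ `ℓ¹` DECAY OF THE BASE POINT**: for an offset `r` with `0 ≤ r_q < (n+1)·M` and `N = M·L`, `L = Lc^m`,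
`e^{−κ₀‖quo_N (r − M•p)‖∞} ≤ e^{(n+1)κ₀}·e^{−(κ₀∕(4·Lc^m))·|p|₁}`. -/
theorem exp_block_to_l1 {M n m : ℕ} [NeZero M] {κ₀ : ℝ} (hκ : 0 ≤ κ₀) {r : Fin (3 + 1) → ℤ}
    (hr : ∀ q, 0 ≤ r q ∧ r q < ((n + 1 : ℕ) : ℤ) * (M : ℤ)) (p : Fin (3 + 1) → ℤ) :
    Real.exp (-(κ₀ * supNorm (quo (M * Lc ^ m) (r - (M : ℤ) • p))))
      ≤ Real.exp ((n + 1 : ℕ) * κ₀) * Real.exp (-(κ₀ / (4 * (Lc : ℝ) ^ m)) * l1 p) := by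
  haveI : NeZero (Lc ^ m) := ⟨pow_ne_zero _ (NeZero.ne Lc)⟩
  -- the base point's `Lc^m`-block label is the contour point's `N`-block label up to `n`
  have h1 := supNorm_quo_sub_le_add (d := 3) M (Lc ^ m) (n := n) (-p) 0 hr
  have e1 : (M : ℤ) • (-p) + r - ((M * Lc ^ m : ℕ) : ℤ) • (0 : Fin (3 + 1) → ℤ) = r - (M : ℤ) • p := by
    rw [smul_zero, sub_zero, smul_neg, neg_add_eq_sub]
  rw [e1, sub_zero] at h1
  have h2 := exp_wobble (κ₀ := κ₀) (s := supNorm (quo (Lc ^ m) (-p))) hκ h1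
  -- block-scale sup norm ↦ fine `ℓ¹`
  have h3 := exp_supNorm_quo_le (d := 3) (N := Lc ^ m) hκ (-p)
  rw [l1_neg_eq] at h3
  have e2 : κ₀ / ((((3 : ℕ) : ℝ) + 1) * ((Lc ^ m : ℕ) : ℝ)) = κ₀ / (4 * (Lc : ℝ) ^ m) := by push_cast; norm_num
  rw [e2] at h3
  calc Real.exp (-(κ₀ * supNorm (quo (M * Lc ^ m) (r - (M : ℤ) • p))))
      ≤ Real.exp ((n : ℕ) * κ₀) * Real.exp (-(κ₀ * supNorm (quo (Lc ^ m) (-p)))) := h2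
    _ ≤ Real.exp ((n : ℕ) * κ₀) * (Real.exp κ₀ * Real.exp (-(κ₀ / (4 * (Lc : ℝ) ^ m)) * l1 p)) :=
        mul_le_mul_of_nonneg_left h3 (Real.exp_nonneg _)
    _ = Real.exp ((n + 1 : ℕ) * κ₀) * Real.exp (-(κ₀ / (4 * (Lc : ℝ) ^ m)) * l1 p) := by
        rw [← mul_assoc, ← Real.exp_add]; push_cast; ring_nf

end Helpers

/-! ## §1 The finite-`j` bounds, uniform in `j` and `m ≥ 1` -/

section Finite

variable {Lc : ℕ} [NeZero Lc]

/-- [our object] **THE (j, m) TRANSPORT WEIGHT AND ITS UNIT DIFFERENCES — SHARP POWERS, ONE RATE** (`d = 3`, every `Lc ≥ 1`): there are `κ₀ > 0`, `C, C′ ≥ 0` with,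
for ALL `m ≥ 1`, `j`, `κ l p ν`,
`|wStepM Lc m j κ l p| ≤ C·((Lc^m)⁵)⁻¹·e^{−(κ₀∕(4·Lc^m))·|p|₁}` and `|wStepM Lc m j κ l (p + e_ν) − wStepM Lc m j κ l p| ≤ C′·((Lc^m)⁶)⁻¹·e^{−(κ₀∕(4·Lc^m))·|p|₁}`
— (N1) ∧ (N1′) (`FineReadoutGradientDecay.exists_wH_decay_and_grad`) read by the decimation contour (`TransportInfinityM.stepColM_eq`). -/
theorem wStepM_sharp :
    ∃ κ₀ C C' : ℝ, 0 < κ₀ ∧ 0 ≤ C ∧ 0 ≤ C' ∧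
      (∀ (m j : ℕ) (κ l : Fin (3 + 1)) (p : Fin (3 + 1) → ℤ), 1 ≤ m →
        |wStepM Lc m j κ l p| ≤ C * (((Lc : ℝ) ^ m) ^ 5)⁻¹ * Real.exp (-(κ₀ / (4 * (Lc : ℝ) ^ m)) * l1 p)) ∧
      (∀ (m j : ℕ) (κ l : Fin (3 + 1)) (p : Fin (3 + 1) → ℤ) (ν : Fin (3 + 1)), 1 ≤ m →
        |wStepM Lc m j κ l (p + Pi.single ν 1) - wStepM Lc m j κ l p|
          ≤ C' * (((Lc : ℝ) ^ m) ^ 6)⁻¹ * Real.exp (-(κ₀ / (4 * (Lc : ℝ) ^ m)) * l1 p)) := by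
  obtain ⟨κ₀, C, C', hκ₀, hC, hC', hN1, hN1'⟩ := exists_wH_decay_and_grad (Lc := Lc)
  -- (N1)/(N1′) at every level `n ≥ 1` (the tree states them at `Lc^(j′+1)`)
  have hN1n : ∀ n : ℕ, 1 ≤ n → ∀ (κ l : Fin (3 + 1)) (z : Fin (3 + 1) → ℤ),
      |wH (N := Lc ^ n) κ l z| ≤ C * ((((Lc ^ n : ℕ) : ℝ)) ^ (3 + 2))⁻¹ * Real.exp (-(κ₀ * supNorm (quo (Lc ^ n) z))) := by
    intro n hn κ l z
    obtain ⟨n', rfl⟩ : ∃ n', n = n' + 1 := ⟨n - 1, by omega⟩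
    exact hN1 n' κ l z
  have hN1'n : ∀ n : ℕ, 1 ≤ n → ∀ (κ l : Fin (3 + 1)) (z : Fin (3 + 1) → ℤ) (ν : Fin (3 + 1)),
      |wH (N := Lc ^ n) κ l (z + Pi.single ν 1) - wH (N := Lc ^ n) κ l z|
        ≤ C' * ((((Lc ^ n : ℕ) : ℝ)) ^ (3 + 3))⁻¹ * Real.exp (-(κ₀ * supNorm (quo (Lc ^ n) z))) := by
    intro n hn κ l z ν
    obtain ⟨n', rfl⟩ : ∃ n', n = n' + 1 := ⟨n - 1, by omega⟩
    exact hN1' n' κ l z ν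
  have hL0 : (0 : ℝ) < Lc := by exact_mod_cast Nat.pos_of_ne_zero (NeZero.ne Lc)
  refine ⟨κ₀, C * Real.exp ((1 + 1 : ℕ) * κ₀), C' * Real.exp ((2 + 1 : ℕ) * κ₀) * Real.exp κ₀, hκ₀, by positivity, by positivity,
    fun m j κ l p hm => ?_, fun m j κ l p ν hm => ?_⟩
  · -- the sup bound
    haveI : NeZero (Lc ^ j) := ⟨pow_ne_zero _ (NeZero.ne Lc)⟩
    have hMne : Lc ^ j ≠ 0 := pow_ne_zero _ (NeZero.ne Lc)
    set E : ℝ := Real.exp (-(κ₀ / (4 * (Lc : ℝ) ^ m)) * l1 p) with hE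
    set B : ℝ := C * ((((Lc ^ (j + m) : ℕ) : ℝ)) ^ (3 + 2))⁻¹ * (Real.exp ((1 + 1 : ℕ) * κ₀) * E) with hB
    have hBnn : 0 ≤ B := by positivity
    -- termwise
    have hterm : ∀ i ∈ LegIdx 3 (Lc ^ j),
        |(((Lc ^ j : ℕ) : ℝ) ^ (3 + 2))⁻¹ * wH (N := Lc ^ (j + m)) κ l (legOff κ i - ((Lc ^ j : ℕ) : ℤ) • p)|
          ≤ (((Lc ^ j : ℕ) : ℝ) ^ (3 + 2))⁻¹ * B := by
      intro i hi
      rw [abs_mul, abs_of_nonneg (by positivity : (0 : ℝ) ≤ (((Lc ^ j : ℕ) : ℝ) ^ (3 + 2))⁻¹)]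
      refine mul_le_mul_of_nonneg_left ?_ (by positivity)
      refine (hN1n (j + m) (by omega) κ l _).trans ?_
      have hexp := exp_block_to_l1 (Lc := Lc) (M := Lc ^ j) (n := 1) (m := m) hκ₀.le (legOff_bounds hi κ) p
      rw [← pow_add] at hexp
      rw [hB]
      exact mul_le_mul_of_nonneg_left hexp (by positivity)
    have hsum : |stepColM (d := 3) Lc j m κ l p| ≤ B := by
      rw [stepColM_eq]
      refine (Finset.abs_sum_le_sum_abs _ _).trans ?_
      refine (Finset.sum_le_sum hterm).trans ?_
      rw [← Finset.sum_mul, sum_inv_pow_LegIdx hMne, one_mul]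
    show |wStepM Lc m j κ l p| ≤ _
    unfold wStepM
    rw [abs_mul, abs_of_nonneg (by positivity : (0 : ℝ) ≤ (Lc : ℝ) ^ (5 * j))]
    calc (Lc : ℝ) ^ (5 * j) * |stepColM (d := 3) Lc j m κ l p| ≤ (Lc : ℝ) ^ (5 * j) * B :=
          mul_le_mul_of_nonneg_left hsum (by positivity)
      _ = C * Real.exp ((1 + 1 : ℕ) * κ₀) * (((Lc : ℝ) ^ m) ^ 5)⁻¹ * E := by
          rw [hB, ← pow_ratio_five (Lc := Lc) j m]; ring
  · -- the difference bound
    haveI : NeZero (Lc ^ j) := ⟨pow_ne_zero _ (NeZero.ne Lc)⟩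
    have hMne : Lc ^ j ≠ 0 := pow_ne_zero _ (NeZero.ne Lc)
    set M : ℕ := Lc ^ j with hM
    set E : ℝ := Real.exp (-(κ₀ / (4 * (Lc : ℝ) ^ m)) * l1 p) with hE
    set B' : ℝ := C' * ((((Lc ^ (j + m) : ℕ) : ℝ)) ^ (3 + 3))⁻¹ * (Real.exp ((2 + 1 : ℕ) * κ₀) * (Real.exp κ₀ * E)) with hB'
    have hB'nn : 0 ≤ B' := by positivity
    -- the difference of the two contour sums, term by term, telescoped into `M` unit steps
    have hdiff : stepColM (d := 3) Lc j m κ l (p + Pi.single ν 1) - stepColM (d := 3) Lc j m κ l p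
        = ∑ i ∈ LegIdx 3 M, (((M : ℕ) : ℝ) ^ (3 + 2))⁻¹ *
            (wH (N := Lc ^ (j + m)) κ l (legOff κ i - ((M : ℕ) : ℤ) • (p + Pi.single ν 1))
              - wH (N := Lc ^ (j + m)) κ l (legOff κ i - ((M : ℕ) : ℤ) • p)) := by
      rw [stepColM_eq, stepColM_eq, ← Finset.sum_sub_distrib]
      refine Finset.sum_congr rfl fun i _ => by ring
    have hshift : ∀ i : (Fin (3 + 1) → ℕ) × ℕ,
        legOff κ i - ((M : ℕ) : ℤ) • p = (legOff κ i - ((M : ℕ) : ℤ) • (p + Pi.single ν 1)) + (M : ℤ) • unitVec ν := by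
      intro i
      ext q
      simp only [Pi.add_apply, Pi.sub_apply, Pi.smul_apply, AffineAveraging.unitVec_apply, Pi.single_apply, smul_eq_mul]
      split_ifs <;> ring
    have hterm : ∀ i ∈ LegIdx 3 M,
        |(((M : ℕ) : ℝ) ^ (3 + 2))⁻¹ *
            (wH (N := Lc ^ (j + m)) κ l (legOff κ i - ((M : ℕ) : ℤ) • (p + Pi.single ν 1))
              - wH (N := Lc ^ (j + m)) κ l (legOff κ i - ((M : ℕ) : ℤ) • p))|
          ≤ (((M : ℕ) : ℝ) ^ (3 + 2))⁻¹ * ((M : ℝ) * B') := by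
      intro i hi
      rw [abs_mul, abs_of_nonneg (by positivity : (0 : ℝ) ≤ (((M : ℕ) : ℝ) ^ (3 + 2))⁻¹)]
      refine mul_le_mul_of_nonneg_left ?_ (by positivity)
      set v : Fin (3 + 1) → ℤ := legOff κ i - ((M : ℕ) : ℤ) • (p + Pi.single ν 1) with hv
      rw [hshift i, ← hv, abs_sub_comm, sub_eq_sum_range_step (fun z => wH (N := Lc ^ (j + m)) κ l z) v ν M]
      refine (Finset.abs_sum_le_sum_abs _ _).trans ?_
      have hstep : ∀ t ∈ Finset.range M,
          |wH (N := Lc ^ (j + m)) κ l (v + (t : ℤ) • unitVec ν + Pi.single ν 1) - wH (N := Lc ^ (j + m)) κ l (v + (t : ℤ) • unitVec ν)| ≤ B' := by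
        intro t ht
        have ht' : t < M := Finset.mem_range.1 ht
        refine (hN1'n (j + m) (by omega) κ l _ ν).trans ?_
        -- the point `v + t•e_ν = (legOff κ i + t•e_ν) − M•(p + e_ν)` has offset in `[0, 3M)`
        have ev : v + (t : ℤ) • unitVec ν = (legOff κ i + (t : ℤ) • unitVec ν) - (M : ℤ) • (p + Pi.single ν 1) := by
          rw [hv]; abel
        have hexp := exp_block_to_l1 (Lc := Lc) (M := M) (n := 2) (m := m) hκ₀.le (legOff_step_bounds hi κ ν ht') (p + Pi.single ν 1)
        rw [← ev, hM, ← pow_add] at hexp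
        -- `|p|₁ ≤ |p + e_ν|₁ + 1`
        have hl1 : Real.exp (-(κ₀ / (4 * (Lc : ℝ) ^ m)) * l1 (p + Pi.single ν 1)) ≤ Real.exp κ₀ * E := by
          rw [hE, ← Real.exp_add, Real.exp_le_exp]
          have hq : 0 ≤ κ₀ / (4 * (Lc : ℝ) ^ m) := by positivity
          have hq1 : κ₀ / (4 * (Lc : ℝ) ^ m) ≤ κ₀ := by
            rw [div_le_iff₀ (by positivity)]
            have : (1 : ℝ) ≤ (Lc : ℝ) ^ m := one_le_pow₀ (by exact_mod_cast Nat.pos_of_ne_zero (NeZero.ne Lc))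
            nlinarith
          have hp := l1_le_l1_add_single_add_one p ν
          nlinarith [l1_nonneg (p + Pi.single ν 1)]
        rw [hB']
        refine mul_le_mul_of_nonneg_left (hexp.trans ?_) (by positivity)
        exact mul_le_mul_of_nonneg_left hl1 (Real.exp_nonneg _)
      refine (Finset.sum_le_sum hstep).trans ?_
      rw [Finset.sum_const, Finset.card_range, nsmul_eq_mul]
    have hsum : |stepColM (d := 3) Lc j m κ l (p + Pi.single ν 1) - stepColM (d := 3) Lc j m κ l p| ≤ (M : ℝ) * B' := by
      rw [hdiff]
      refine (Finset.abs_sum_le_sum_abs _ _).trans ?_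
      refine (Finset.sum_le_sum hterm).trans ?_
      rw [← Finset.sum_mul, sum_inv_pow_LegIdx hMne, one_mul]
    show |wStepM Lc m j κ l (p + Pi.single ν 1) - wStepM Lc m j κ l p| ≤ _
    unfold wStepM
    rw [← mul_sub, abs_mul, abs_of_nonneg (by positivity : (0 : ℝ) ≤ (Lc : ℝ) ^ (5 * j))]
    calc (Lc : ℝ) ^ (5 * j) * |stepColM (d := 3) Lc j m κ l (p + Pi.single ν 1) - stepColM (d := 3) Lc j m κ l p|
        ≤ (Lc : ℝ) ^ (5 * j) * ((M : ℝ) * B') := mul_le_mul_of_nonneg_left hsum (by positivity)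
      _ = C' * Real.exp ((2 + 1 : ℕ) * κ₀) * Real.exp κ₀ * (((Lc : ℝ) ^ m) ^ 6)⁻¹ * E := by
          rw [hB', hM, ← pow_ratio_six (Lc := Lc) j m]; push_cast; ring

/-- [our object] **THE SUP BOUND ALONE** (`p = 5`). -/
theorem abs_wStepM_le_sharp :
    ∃ κ₀ C : ℝ, 0 < κ₀ ∧ 0 ≤ C ∧ ∀ (m j : ℕ) (κ l : Fin (3 + 1)) (p : Fin (3 + 1) → ℤ), 1 ≤ m →
      |wStepM Lc m j κ l p| ≤ C * (((Lc : ℝ) ^ m) ^ 5)⁻¹ * Real.exp (-(κ₀ / (4 * (Lc : ℝ) ^ m)) * l1 p) := by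
  obtain ⟨κ₀, C, _, hκ₀, hC, _, h, _⟩ := wStepM_sharp (Lc := Lc)
  exact ⟨κ₀, C, hκ₀, hC, h⟩

/-- [our object] **THE FIRST-DIFFERENCE BOUND ALONE** (`p = 6`). -/
theorem abs_wStepM_sub_le_sharp :
    ∃ κ₀ C' : ℝ, 0 < κ₀ ∧ 0 ≤ C' ∧ ∀ (m j : ℕ) (κ l : Fin (3 + 1)) (p : Fin (3 + 1) → ℤ) (ν : Fin (3 + 1)), 1 ≤ m →
      |wStepM Lc m j κ l (p + Pi.single ν 1) - wStepM Lc m j κ l p|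
        ≤ C' * (((Lc : ℝ) ^ m) ^ 6)⁻¹ * Real.exp (-(κ₀ / (4 * (Lc : ℝ) ^ m)) * l1 p) := by
  obtain ⟨κ₀, _, C', hκ₀, _, hC', _, h⟩ := wStepM_sharp (Lc := Lc)
  exact ⟨κ₀, C', hκ₀, hC', h⟩

end Finite

/-! ## §2 The perfect column (`j → ∞`), every `m ≥ 1` -/

section Perfect

variable {Lc : ℕ} [NeZero Lc]

/-- [our object] **THE PERFECT MINIMISER COLUMN AND ITS UNIT DIFFERENCES — SHARP POWERS `5` AND `6`, ONE RATE, `m`-UNIFORM** (`d = 3`, `2 ≤ Lc`):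
there are `κ₀ > 0`, `C, C′ ≥ 0` with, for ALL `m ≥ 1`, `κ l p ν`,
`|colOf (KPerf Lc (sfStep Lc) (smStep 3 Lc) m) κ l p| ≤ C·((Lc^m)⁵)⁻¹·e^{−(κ₀∕(4·Lc^m))·|p|₁}` and
`|colOf (…) κ l (p + e_ν) − colOf (…) κ l p| ≤ C′·((Lc^m)⁶)⁻¹·e^{−(κ₀∕(4·Lc^m))·|p|₁}` — §1 passed through the entrywise limit
`TransportInfinityM.tendsto_wStepM_of_decays` on `KSlotJMHolds.kSlotJM_holds` (X1m-K).  Row IPROF-UNIF's displayed shape with `p = 5`; row MS-2 at order 1. -/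
theorem colOf_KPerf_sharp (hLc : 2 ≤ Lc) :
    ∃ κ₀ C C' : ℝ, 0 < κ₀ ∧ 0 ≤ C ∧ 0 ≤ C' ∧
      (∀ m : ℕ, 1 ≤ m → ∀ (κ l : Fin (3 + 1)) (p : Fin (3 + 1) → ℤ),
        |colOf (KPerf (d := 3) Lc (sfStep Lc) (smStep 3 Lc) m) κ l p|
          ≤ C * (((Lc : ℝ) ^ m) ^ 5)⁻¹ * Real.exp (-(κ₀ / (4 * (Lc : ℝ) ^ m)) * l1 p)) ∧
      (∀ m : ℕ, 1 ≤ m → ∀ (κ l : Fin (3 + 1)) (p : Fin (3 + 1) → ℤ) (ν : Fin (3 + 1)),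
        |colOf (KPerf (d := 3) Lc (sfStep Lc) (smStep 3 Lc) m) κ l (p + Pi.single ν 1)
            - colOf (KPerf (d := 3) Lc (sfStep Lc) (smStep 3 Lc) m) κ l p|
          ≤ C' * (((Lc : ℝ) ^ m) ^ 6)⁻¹ * Real.exp (-(κ₀ / (4 * (Lc : ℝ) ^ m)) * l1 p)) := by
  obtain ⟨κ₀, C, C', hκ₀, hC, hC', hsup, hsub⟩ := wStepM_sharp (Lc := Lc)
  refine ⟨κ₀, C, C', hκ₀, hC, hC', fun m hm κ l p => ?_, fun m hm κ l p ν => ?_⟩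
  · obtain ⟨CK, δ, cK, θ, _, _, hθ1, _, hKall⟩ := kSlotJM_holds (Lc := Lc) hLc hm
    have ht := tendsto_wStepM_of_decays (Lc := Lc) (sfStep_mul_smStep_three Lc) m hKall hθ1 κ l p
    exact le_of_tendsto' ht.abs fun j => hsup m j κ l p hm
  · obtain ⟨CK, δ, cK, θ, _, _, hθ1, _, hKall⟩ := kSlotJM_holds (Lc := Lc) hLc hm
    have ht₁ := tendsto_wStepM_of_decays (Lc := Lc) (sfStep_mul_smStep_three Lc) m hKall hθ1 κ l (p + Pi.single ν 1)
    have ht₀ := tendsto_wStepM_of_decays (Lc := Lc) (sfStep_mul_smStep_three Lc) m hKall hθ1 κ l p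
    exact le_of_tendsto' (ht₁.sub ht₀).abs fun j => hsub m j κ l p ν hm

/-- [our object] **ROW IPROF-UNIF's DISPLAYED SHAPE WITH `p = 5`** (`2 ≤ Lc`): `∃ κ₀ C, 0 < κ₀ ∧ 0 ≤ C ∧ ∀ m ≥ 1, ∀ κ l p,
|colOf (KPerf Lc (sfStep Lc) (smStep 3 Lc) m) κ l p| ≤ C·((Lc^m)⁵)⁻¹·e^{−(κ₀∕(4·Lc^m))·|p|₁}`. -/
theorem abs_colOf_KPerf_le_sharp (hLc : 2 ≤ Lc) :
    ∃ κ₀ C : ℝ, 0 < κ₀ ∧ 0 ≤ C ∧ ∀ m : ℕ, 1 ≤ m → ∀ (κ l : Fin (3 + 1)) (p : Fin (3 + 1) → ℤ),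
      |colOf (KPerf (d := 3) Lc (sfStep Lc) (smStep 3 Lc) m) κ l p|
        ≤ C * (((Lc : ℝ) ^ m) ^ 5)⁻¹ * Real.exp (-(κ₀ / (4 * (Lc : ℝ) ^ m)) * l1 p) := by
  obtain ⟨κ₀, C, _, hκ₀, hC, _, h, _⟩ := colOf_KPerf_sharp (Lc := Lc) hLc
  exact ⟨κ₀, C, hκ₀, hC, h⟩

/-- [our object] **ROW MS-2 AT ORDER 1 FOR THE PERFECT COLUMN** (`2 ≤ Lc`): `∃ κ₀ C′, 0 < κ₀ ∧ 0 ≤ C′ ∧ ∀ m ≥ 1, ∀ κ l p ν,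
|colOf (KPerf … m) κ l (p + e_ν) − colOf (KPerf … m) κ l p| ≤ C′·((Lc^m)⁶)⁻¹·e^{−(κ₀∕(4·Lc^m))·|p|₁}`. -/
theorem abs_colOf_KPerf_sub_le_sharp (hLc : 2 ≤ Lc) :
    ∃ κ₀ C' : ℝ, 0 < κ₀ ∧ 0 ≤ C' ∧ ∀ m : ℕ, 1 ≤ m → ∀ (κ l : Fin (3 + 1)) (p : Fin (3 + 1) → ℤ) (ν : Fin (3 + 1)),
      |colOf (KPerf (d := 3) Lc (sfStep Lc) (smStep 3 Lc) m) κ l (p + Pi.single ν 1)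
          - colOf (KPerf (d := 3) Lc (sfStep Lc) (smStep 3 Lc) m) κ l p|
        ≤ C' * (((Lc : ℝ) ^ m) ^ 6)⁻¹ * Real.exp (-(κ₀ / (4 * (Lc : ℝ) ^ m)) * l1 p) := by
  obtain ⟨κ₀, _, C', hκ₀, _, hC', _, h⟩ := colOf_KPerf_sharp (Lc := Lc) hLc
  exact ⟨κ₀, C', hκ₀, hC', h⟩

end Perfect

end Summit.QuantumFields.BalabanUV.Beta.FP.PerfectColumnSharp

end
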